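import Mathlib.LinearAlgebra.Matrix.PosDef
import Mathlib.Analysis.InnerProductSpace.PiL2

/-!
# Crux `AnchorGap` (stmt-QuantumFields-11141), line `registered` — stub GRAM

Schur product with a Gram matrix of unit vectors preserves positive definiteness: in the
Battle–Brydges–Federbush cluster expansion the interpolated covariance is
`C(σ)_{ij} = σ({blk i, blk j}) C_{ij}`, and the interpolation factors form a Gram matrix
`⟪u_a, u_b⟫` of UNIT vectors (`BattleFederbush.Script.exists_unit_gram`); this file shows that
such a Hadamard product stays positive definite, so the interpolated Gaussians exist.

* `gramHadamard_dotProduct_mulVec` — the quadratic form of `(⟪v_i, v_j⟫ C_{ij})` splits over the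
  coordinates of the `v_i`: `xᵀ (G ∘ C) x = Σ_n (x ∘ v(n))ᵀ C (x ∘ v(n))`;
* `stub_gramHadamardPosDef` — for `C` positive definite, atoms `blk : ι → β` and unit vectors
  `u_b ∈ ℝ^N`, the matrix `(⟪u_{blk i}, u_{blk j}⟫ C_{ij})_{ij}` is positive definite.
-/

set_option autoImplicit false

namespace Summit.QuantumFields.YangMills.Theorems.AnchorGap

open scoped Matrix InnerProductSpace

/-- **Coordinate splitting of the Hadamard quadratic form.** For `x : ι → ℝ` and vectors
`v_i ∈ ℝ^N`, `Σ_{ij} x_i ⟪v_i, v_j⟫ C_{ij} x_j = Σ_n Σ_{ij} (x_i v_i(n)) C_{ij} (x_j v_j(n))`: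
expand the inner product coordinatewise and swap the sums. [folklore] -/
theorem gramHadamard_dotProduct_mulVec {ι : Type} [Fintype ι] (C : Matrix ι ι ℝ) (N : ℕ)
    (v : ι → EuclideanSpace ℝ (Fin N)) (x : ι → ℝ) :
    x ⬝ᵥ ((Matrix.of fun i j : ι => inner ℝ (v i) (v j) * C i j) *ᵥ x)
      = ∑ n : Fin N, (fun i => x i * v i n) ⬝ᵥ (C *ᵥ fun i => x i * v i n) := by
  have hL : x ⬝ᵥ ((Matrix.of fun i j : ι => inner ℝ (v i) (v j) * C i j) *ᵥ x)
      = ∑ i : ι, ∑ j : ι, ∑ n : Fin N, (x i * v i n) * (C i j * (x j * v j n)) := by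
    simp only [dotProduct, Matrix.mulVec, Matrix.of_apply, PiLp.inner_apply, RCLike.inner_apply,
      conj_trivial, Finset.sum_mul, Finset.mul_sum]
    refine Finset.sum_congr rfl fun i _ => Finset.sum_congr rfl fun j _ =>
      Finset.sum_congr rfl fun n _ => ?_
    ring
  have hR : ∑ n : Fin N, (fun i => x i * v i n) ⬝ᵥ (C *ᵥ fun i => x i * v i n)
      = ∑ n : Fin N, ∑ i : ι, ∑ j : ι, (x i * v i n) * (C i j * (x j * v j n)) := by
    simp only [dotProduct, Matrix.mulVec, Finset.mul_sum]
  rw [hL, hR]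
  calc ∑ i : ι, ∑ j : ι, ∑ n : Fin N, (x i * v i n) * (C i j * (x j * v j n))
      = ∑ i : ι, ∑ n : Fin N, ∑ j : ι, (x i * v i n) * (C i j * (x j * v j n)) :=
        Finset.sum_congr rfl fun i _ => Finset.sum_comm
    _ = ∑ n : Fin N, ∑ i : ι, ∑ j : ι, (x i * v i n) * (C i j * (x j * v j n)) :=
        Finset.sum_comm

/-- **Stub GRAM (Schur product with a Gram matrix of unit vectors preserves positive
definiteness).** For a positive definite `C` on `ι`, atoms `blk : ι → β` and unit vectors `u_b`,
the Hadamard product `(⟪u_{blk i}, u_{blk j}⟫ C_{ij})` is positive definite: it is symmetric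
(both factors are), `xᵀ(G∘C)x = Σ_n (x∘u(n))ᵀ C (x∘u(n)) ≥ 0` with `x∘u(n) := (x_i u_{blk i}(n))_i`,
and if `x_i ≠ 0` then, `u_{blk i}` being a unit vector, some coordinate `u_{blk i}(n) ≠ 0`, so
`x∘u(n) ≠ 0` and the `n`-th term is `> 0`.  With `BattleFederbush.Script.exists_unit_gram` (the
decoupled interpolation factors ARE such a Gram matrix) this keeps every interpolated covariance
of the cluster expansion positive definite. [folklore] -/
theorem stub_gramHadamardPosDef :
    ∀ (ι β : Type) [Fintype ι] [DecidableEq ι] [Fintype β] (blk : ι → β) (C : Matrix ι ι ℝ), C.PosDef → ∀ (N : ℕ) (u : β → EuclideanSpace ℝ (Fin N)), (∀ b : β, ‖u b‖ = 1) → (Matrix.of fun i j : ι => inner ℝ (u (blk i)) (u (blk j)) * C i j).PosDef := by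
  intro ι β _ _ _ blk C hC N u hu
  refine Matrix.PosDef.of_dotProduct_mulVec_pos ?_ ?_
  · -- symmetry: both factors are symmetric
    refine Matrix.IsHermitian.ext fun i j => ?_
    have h : C j i = C i j := by simpa only [star_trivial] using hC.isHermitian.apply i j
    simp only [Matrix.of_apply, star_trivial]
    rw [real_inner_comm, h]
  · intro x hx
    rw [star_trivial, gramHadamard_dotProduct_mulVec C N (fun i => u (blk i)) x]
    -- a nonzero coordinate of `x` and a nonzero coordinate of the corresponding unit vector
    obtain ⟨i₀, hi₀⟩ := Function.ne_iff.mp hx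
    have hn : ∃ n₀ : Fin N, u (blk i₀) n₀ ≠ 0 := by
      by_contra h
      have h0 : u (blk i₀) = 0 := PiLp.ext fun n => by simpa using not_exists.mp h n
      have h1 := hu (blk i₀)
      rw [h0, norm_zero] at h1
      exact zero_ne_one h1
    obtain ⟨n₀, hn₀⟩ := hn
    refine Finset.sum_pos' (fun n _ => ?_) ⟨n₀, Finset.mem_univ _, ?_⟩
    · simpa only [star_trivial] using
        hC.posSemidef.dotProduct_mulVec_nonneg (fun i => x i * u (blk i) n)
    · have hy : (fun i => x i * u (blk i) n₀) ≠ 0 := fun h =>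
        mul_ne_zero hi₀ hn₀ (congr_fun h i₀)
      simpa only [star_trivial] using hC.dotProduct_mulVec_pos hy

end Summit.QuantumFields.YangMills.Theorems.AnchorGap
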